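import Literature.Computability.QuantumComplexity.PathModelTemperleyLieb
import HarnessLib

/-!
# Cup sliding in the AJL path-model representation

Topic `Literature/Computability/QuantumComplexity`; sibling proof file of
`PathModelRepresentation.lean` (crossing matrices `ρ_A(σ_i^{±1}) = A^{±1} Φ_i + A^{∓1} 1`,
`ajlCrossingMatrix`) and `PathModelTemperleyLieb.lean` (the Temperley–Lieb relations of the
`Φ_i`, AJL Claim 3.1). It records the algebraic form of the second Reidemeister move for a cup,
i.e. of the fact that a strand slides freely over (or under) a pair of strands closed off by a cap
(Kauffman 1987, §2: the bracket is invariant under regular isotopy; Aharonov–Jones–Landau 2009,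
Claim 2.2 with Claim 2.4):

  `ρ(σ_i^ε) ρ(σ_{i+1}^ε) Φ_i = Φ_{i+1} Φ_i`,  `ρ(σ_{i+1}^ε) ρ(σ_i^ε) Φ_{i+1} = Φ_i Φ_{i+1}`

for either common sign `ε` (`crossing_mul_crossing_succ_mul_ajlPhiC`,
`crossing_succ_mul_crossing_mul_ajlPhiC`): expanding, the coefficient of `Φ_i` is
`c₁² + c₂² + c₁ c₂ d = A² + A⁻² + d = 0` and `c₁ c₂ = A A⁻¹ = 1`. In vector form
(`crossing_mul_crossing_succ_mulVec`): on the range of `Φ_i` — the states in which strands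
`i, i+1` are capped, `Φ_i = d e_i` — the two crossings act as `Φ_{i+1}`, moving the cap one strand
to the right; symmetrically to the left. This is the mechanism by which a pair of strands of
trivial total charge braids trivially, used for the encoded two-qubit gates in the
`PromiseBQP`-hardness of the Jones polynomial (Aharonov–Arad 2011, §3).

No definitions and no new statements of results are introduced; everything is proved.

## References

* D. Aharonov, V. Jones, Z. Landau, *A polynomial quantum algorithm for approximating the Jones
  polynomial*, Algorithmica 55 (2009); arXiv:quant-ph/0511096, §2.6 Def. 2.6, §2.7 Claim 2.2,
  §2.12 Claim 2.4, §3.1 Claim 3.1 [AharonovJonesLandau2009].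
* L. H. Kauffman, *State models and the Jones polynomial*, Topology 26 (1987) 395–407, §2
  (regular isotopy invariance of the bracket).
-/

noncomputable section

open Matrix

namespace Literature.Computability.QuantumComplexity

variable {n k : ℕ} {i j : Fin (n - 1)}

/-- The abstract computation: if `P² = d P` and `P Q P = P`, and the scalars satisfy
`c₁ c₂ = 1`, `c₁² + c₂² = -d`, then `(c₁ P + c₂ 1)(c₁ Q + c₂ 1) P = Q P`.
[cite: AharonovJonesLandau2009, Claim 2.2 and Claim 2.4] -/
theorem smul_add_smul_one_mul_mul_eq {ι : Type*} [Fintype ι] [DecidableEq ι]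
    {P Q : Matrix ι ι ℂ} {c₁ c₂ d : ℂ} (hPP : P * P = d • P) (hPQP : P * Q * P = P)
    (h12 : c₁ * c₂ = 1) (hsq : c₁ ^ 2 + c₂ ^ 2 = -d) :
    (c₁ • P + c₂ • (1 : Matrix ι ι ℂ)) * (c₁ • Q + c₂ • (1 : Matrix ι ι ℂ)) * P = Q * P := by
  have e : (c₁ • P + c₂ • (1 : Matrix ι ι ℂ)) * (c₁ • Q + c₂ • (1 : Matrix ι ι ℂ)) * P =
      (c₁ ^ 2) • (P * Q * P) + (c₁ * c₂) • (P * P) + (c₁ * c₂) • (Q * P) + (c₂ ^ 2) • P := by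
    simp only [add_mul, mul_add, Matrix.smul_mul, Matrix.mul_smul, Matrix.one_mul, Matrix.mul_one,
      smul_smul, sq]
    rw [mul_comm c₂ c₁]
    abel
  rw [e, hPQP, hPP, h12, one_smul, one_smul]
  calc c₁ ^ 2 • P + d • P + Q * P + c₂ ^ 2 • P = (c₁ ^ 2 + c₂ ^ 2 + d) • P + Q * P := by
        rw [add_smul, add_smul]; abel
    _ = Q * P := by rw [hsq, neg_add_cancel, zero_smul, zero_add]

/-- The two coefficients of a crossing multiply to `1`: `A A⁻¹ = 1`.
[cite: AharonovJonesLandau2009, Def. 2.6] -/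
theorem crossingWeight_ajlPoint_true_mul_false (k : ℕ) (ε : Bool) :
    crossingWeight (ajlPoint k) ε true * crossingWeight (ajlPoint k) ε false = 1 := by
  cases ε <;> simp [mul_inv_cancel₀ (ajlPoint_ne_zero k), inv_mul_cancel₀ (ajlPoint_ne_zero k)]

/-- The squares of the two coefficients of a crossing sum to `A² + A⁻² = -d`.
[cite: AharonovJonesLandau2009, §2.13] -/
theorem crossingWeight_ajlPoint_sq_add_sq (k : ℕ) (ε : Bool) :
    crossingWeight (ajlPoint k) ε true ^ 2 + crossingWeight (ajlPoint k) ε false ^ 2 =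
      -(ajlLoopValue k : ℂ) := by
  rw [← loopValue_ajlPoint, loopValue]
  cases ε
  · simp
  · simp [add_comm]

/-- **Cup sliding to the right**: `ρ(σ_i^ε) ρ(σ_{i+1}^ε) Φ_i = Φ_{i+1} Φ_i` (in the matrix order of
`ajlBraidMatrixFn`, letter `σ_i^ε` leftmost: on kets, `σ_{i+1}^ε` acts first). A strand passes
over (`ε = 1`) or under (`ε = 0`) the capped pair `i, i+1`, which ends up at `i+1, i+2`.
[cite: AharonovJonesLandau2009, Claim 2.2 and Claim 3.1] -/
theorem crossing_mul_crossing_succ_mul_ajlPhiC (hij : (j : ℕ) = i + 1) (ε : Bool) :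
    ajlCrossingMatrix k (i, ε) * ajlCrossingMatrix k (j, ε) * ajlPhiC k n i =
      ajlPhiC k n j * ajlPhiC k n i :=
  smul_add_smul_one_mul_mul_eq (ajlPhiC_mul_self k n i) (ajlPhiC_mul_succ_mul hij)
    (crossingWeight_ajlPoint_true_mul_false k ε) (crossingWeight_ajlPoint_sq_add_sq k ε)

/-- **Cup sliding to the left**: `ρ(σ_{i+1}^ε) ρ(σ_i^ε) Φ_{i+1} = Φ_i Φ_{i+1}`.
[cite: AharonovJonesLandau2009, Claim 2.2 and Claim 3.1] -/
theorem crossing_succ_mul_crossing_mul_ajlPhiC (hij : (j : ℕ) = i + 1) (ε : Bool) :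
    ajlCrossingMatrix k (j, ε) * ajlCrossingMatrix k (i, ε) * ajlPhiC k n j =
      ajlPhiC k n i * ajlPhiC k n j :=
  smul_add_smul_one_mul_mul_eq (ajlPhiC_mul_self k n j) (ajlPhiC_succ_mul_mul_succ hij)
    (crossingWeight_ajlPoint_true_mul_false k ε) (crossingWeight_ajlPoint_sq_add_sq k ε)

/-- **Cup sliding, vector form (to the right)**: on a state in the range of `Φ_i` (strands
`i, i+1` capped) the pair of crossings `σ_i^ε σ_{i+1}^ε` acts as `Φ_{i+1}`; in particular the
image lies in the range of `Φ_{i+1}`. [cite: AharonovJonesLandau2009, Claim 2.2 and Claim 3.1] -/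
theorem crossing_mul_crossing_succ_mulVec (hij : (j : ℕ) = i + 1) (ε : Bool)
    (u : Cryptography.QReg n → ℂ) :
    (ajlCrossingMatrix k (i, ε) * ajlCrossingMatrix k (j, ε)) *ᵥ (ajlPhiC k n i *ᵥ u) =
      ajlPhiC k n j *ᵥ (ajlPhiC k n i *ᵥ u) := by
  rw [mulVec_mulVec, mulVec_mulVec, crossing_mul_crossing_succ_mul_ajlPhiC hij ε]

/-- **Cup sliding, vector form (to the left)**: on the range of `Φ_{i+1}` the pair
`σ_{i+1}^ε σ_i^ε` acts as `Φ_i`. [cite: AharonovJonesLandau2009, Claim 2.2 and Claim 3.1] -/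
theorem crossing_succ_mul_crossing_mulVec (hij : (j : ℕ) = i + 1) (ε : Bool)
    (u : Cryptography.QReg n → ℂ) :
    (ajlCrossingMatrix k (j, ε) * ajlCrossingMatrix k (i, ε)) *ᵥ (ajlPhiC k n j *ᵥ u) =
      ajlPhiC k n i *ᵥ (ajlPhiC k n j *ᵥ u) := by
  rw [mulVec_mulVec, mulVec_mulVec, crossing_succ_mul_crossing_mul_ajlPhiC hij ε]

/-- A single crossing fixes the states in the range of its own `Φ_i` up to the scalar
`c₁ d + c₂` (`= A d + A⁻¹` for `σ_i`): a twist of a capped pair is a phase.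
[cite: AharonovJonesLandau2009, Def. 2.6 and Claim 2.4] -/
theorem crossing_mul_ajlPhiC (k n : ℕ) (i : Fin (n - 1)) (ε : Bool) :
    ajlCrossingMatrix k (i, ε) * ajlPhiC k n i =
      (crossingWeight (ajlPoint k) ε true * ajlLoopValue k + crossingWeight (ajlPoint k) ε false) •
        ajlPhiC k n i := by
  change (crossingWeight (ajlPoint k) ε true • ajlPhiC k n i +
      crossingWeight (ajlPoint k) ε false • (1 : Matrix _ _ ℂ)) * ajlPhiC k n i = _
  rw [add_mul, Matrix.smul_mul, Matrix.smul_mul, Matrix.one_mul, ajlPhiC_mul_self, smul_smul,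
    ← add_smul]

/-- A single crossing acts as the scalar `c₂` (`= A⁻¹` for `σ_i`) on the kernel of its own `Φ_i`:
a twist of a pair of strands in the complementary channel is the other phase.
[cite: AharonovJonesLandau2009, Def. 2.6] -/
theorem crossing_mulVec_of_ajlPhiC_mulVec_eq_zero (k : ℕ) (i : Fin (n - 1)) (ε : Bool)
    {v : Cryptography.QReg n → ℂ} (hv : ajlPhiC k n i *ᵥ v = 0) :
    ajlCrossingMatrix k (i, ε) *ᵥ v = crossingWeight (ajlPoint k) ε false • v := by
  change (crossingWeight (ajlPoint k) ε true • ajlPhiC k n i +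
      crossingWeight (ajlPoint k) ε false • (1 : Matrix _ _ ℂ)) *ᵥ v = _
  rw [add_mulVec, smul_mulVec, smul_mulVec, hv, smul_zero, zero_add, one_mulVec]

end Literature.Computability.QuantumComplexity

end
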